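import Summits.BirchSwinnertonDyer.BirchSwinnertonDyer.Theses.KolyvaginRankRigidityAtTwo
import Summits.BirchSwinnertonDyer.BirchSwinnertonDyer.Theorems.KolyvaginRankRigidityAtTwoAdmissibleAtTwo
import Summits.BirchSwinnertonDyer.BirchSwinnertonDyer.Theorems.KatoDescentTamePotSupersingularJetchevIrreducibleReadingSignUnconditional
import HarnessLib

/-!
# Crux V2♭ `KolyvaginCorankLowerBoundAtTwo` (stmt-BirchSwinnertonDyer-24623), line `kolyvagin_depth_split`:
# stub T3 `stub_conjSign` — complex conjugation acts on the depth-`ν` Kolyvagin classes AT `p = 2` by ONE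
# sign, `τ_* c_M(n) = ε c_M(n)`, `ε = −w(E)·(−1)^ν` (Gross 1991, Prop. 5.4)

Gross 1991 (LMS LNS 153), §5: Prop. 5.3 *"`y_n^τ = ε y_n^{σ'}` + (torsion)"* (`ε` the eigenvalue of the
Fricke involution on the newform, `= −`(sign of the functional equation) `= −w(E)`), and Prop. 5.4:
*"(1) The class `[P_n]` lies in the `ε_n = ε·(−1)^{f_n}` eigenspace for `τ` … (2) The class `c(n)` lies
in the `ε_n`-eigenspace for `τ` in `H¹(K, E_p)"* (McCallum 1991, §5: `ε_r = (−1)^r ε`). This file proves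
the registered stub T3 of the line skeleton
`Cruxes/KolyvaginCorankLowerBoundAtTwo/Lines/kolyvagin_depth_split.lean` AT THE PRIME `2`, with NO named
input, by re-running bsd-jet's unconditional odd-`p` assembly `JET.sign_conjAct_kolyvaginClass`
(`Rank1Residual/JET/KolyvaginClassSignUnconditional.lean`) with the one `p`-dependent input — the
admissibility `E(K[m])[p^M] = 0`, `Γ_K`-stability of `E(K[m]) ⊆ E(K̄)` (Gross Lemma 4.3 / McCallum (5)) —
taken from the route's landed `p = 2` theorem
`KolyvaginAtTwo.isAdmissible_pointsSubgroup_two_of_heegner` (surjective `ρ̄_{E,2}`, odd `d_K`, Heegner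
hypothesis):

* Gross Prop. 5.4 (2) for the concrete class at Zhang–Kolyvagin levels and ANY prime:
  `JET.conjAct_kolyvaginClass_eq_sign_smul_zhang` (Theorems/Rank1ResidualJetKolyvaginClassSign), which is
  the Literature cocycle functoriality `conjAct_kolyvaginClass_eq_smul` on the admissible branch (junk
  branch trivial) fed with Prop. 5.4 (1) `τ P(m) = ε_m P(m) + p^M B` (dihedral law `τστ = σ⁻¹`,
  `τ D_ℓ τ ≡ −D_ℓ (mod ℓ + 1)`, `[D_m y_m]` fixed by `G_m` mod `p^M`);
* Gross Prop. 5.3 at every divisor `m` of the conductor (all `≠ 0`, prime to `N_E`), UNCONDITIONAL: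
  `JET.exists_mem_ringClassGal_isOfFinAddOrder_conj_sub_smul` (Shimura reciprocity at conductor `m`);
* data at the divisors: `nonempty_kolyvaginHeegnerData_of_grossCM` with the two Gross §3 CM facts
  discharged by their `_holds` theorems.

The sign is `ε = −w(E)·(−1)^ν` (`W.rootNumber`), uniform in the conductor `n` of depth `ν`, the datum and
the level, as the stub demands.

HONEST FRAMING: a sign computation on the habitat of V2♭; theorems only (no definition, no named fact, no
`sorry`); it closes the registered stub T3 of the line and nothing else — V2♭ keeps its other stubs, and
BSD is not proved by any of this.

References: [cite: GrossLMS1991, §5 Prop. 5.3, Prop. 5.4 (1)–(2) (p. 243); §3 (3.1), Lemma 4.3]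
[cite: McCallumLMS1991, §4 (5), §5 (ε_r = (−1)^r ε)] [cite: WZhang2014, Notations (xii)].
-/

set_option autoImplicit false
-- the Theorems namespace of this sub repeats the summit name by design (D-0017 nested layout)
set_option linter.dupNamespace false

noncomputable section

open scoped Classical

open WeierstrassCurve Literature.NumberTheory.EllipticCurves
  Literature.NumberTheory.EllipticCurves.ModularForms NumberField IsDedekindDomain
open Summit.BirchSwinnertonDyer.BirchSwinnertonDyer.Theses.KolyvaginRankRigidityAtTwo
open Summit.BirchSwinnertonDyer.Rank1Residual.X11b Summit.BirchSwinnertonDyer.Rank1Residual.JET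

namespace Summit.BirchSwinnertonDyer.BirchSwinnertonDyer.Theorems.KolyvaginLowerBoundAtTwo

section OneConductor

-- `K : Type`: the tree's ring-class class field theory is universe `0`.
variable {K : Type} [Field K] [NumberField K] {W : WeierstrassCurve ℚ}

/-- **Gross 1991 Prop. 5.4 for the concrete class AT `p = 2`, one conductor, UNCONDITIONAL**: for `E/ℚ`
globally minimal with `ρ̄_{E,2}` onto, `K` imaginary quadratic with odd `d_K ∉ {−3, −4}` and the Heegner
hypothesis for `N = N_E`, the non-trivial `τ ∈ Aut(K/ℚ)`, a frame `(Dt, β, ι)`, a square-free conductor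
`c` all of whose prime factors are Zhang–Kolyvagin primes at `2` of index `≥ k ≥ 1`, and ANY datum `d` of
conductor `c`: `τ_* c_k(c) = (−w(E)·(−1)^{#primes of c}) • c_k(c)` in `H¹(K, E[2^k])`. bsd-jet's
`JET.sign_conjAct_kolyvaginClass` verbatim with the admissibility at `2` from
`KolyvaginAtTwo.isAdmissible_pointsSubgroup_two_of_heegner`.
[cite: GrossLMS1991, §5 Prop. 5.3, Prop. 5.4 (1)–(2) (p. 243)] [cite: McCallumLMS1991, §5 (ε_r = (−1)^r ε)] -/
theorem conjAct_kolyvaginClass_two_eq_sign_smul [W.IsElliptic] [W.IsGloballyMinimal]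
    [NeZero (W.conductorNorm ℤ)] (hs : W.HasSurjectiveModNGaloisRep 2)
    (hK : IsImaginaryQuadratic K) (hD3 : NumberField.discr K ≠ -3) (hD4 : NumberField.discr K ≠ -4)
    (hodd : Odd (NumberField.discr K)) (hH : SatisfiesHeegnerHypothesis (W.conductorNorm ℤ) K)
    (τ : K ≃ₐ[ℚ] K) (hτ : τ ≠ 1)
    (Dt : ModularParametrizationData W (W.conductorNorm ℤ)) (β : ℤ) (ι : K →+* ℂ)
    {c : ℕ} (hc : Squarefree c) {k : ℕ} (hk : 1 ≤ k)
    (hcK : ∀ ℓ ∈ c.primeFactors, Zhang2014.IsKolyvaginPrime (W.conductorNorm ℤ) W K 2 ℓ ∧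
      k ≤ Zhang2014.kolyvaginIndex W 2 ℓ)
    (d : KolyvaginHeegnerData Dt β ι c) :
    conjAct W τ ((2 ^ k : ℕ) : ℤ) (d.kolyvaginClass Nat.prime_two k) =
      (-W.rootNumber * (-1) ^ c.primeFactors.card) • d.kolyvaginClass Nat.prime_two k := by
  have hCM1 : phi_heegnerPointOfConductor_mem_range_map_ringClassField (W.conductorNorm ℤ) W K :=
    phi_heegnerPointOfConductor_mem_range_map_ringClassField_holds (W.conductorNorm ℤ) W K
  have hCM2 : exists_generator_ringClassGalOver K := exists_generator_ringClassGalOver_holds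
  have hND : IsCoprime (W.conductorNorm ℤ : ℤ) (NumberField.discr K) :=
    KolyvaginAssembly.isCoprime_discr_of_satisfiesHeegnerHypothesis hK hH
  have hD : NumberField.discr K < -4 := KolyvaginAssembly.discr_lt_neg_four hK ⟨hD3, hD4⟩
  have hinert : ∀ (m' : ℕ), m' ∣ c → ∀ q ∈ m'.primeFactors, (Ideal.span {(q : 𝓞 K)}).IsPrime :=
    fun m' hm' q hq ↦ (hcK q (Nat.primeFactors_mono hm' hc.ne_zero hq)).1.2.2.2.2.1
  -- data at every divisor of `c` (the given `d` at `c` itself)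
  have hne : ∀ m' : ℕ, m' ∣ c → Nonempty (KolyvaginHeegnerData Dt β ι m') := fun m' hm' ↦
    nonempty_kolyvaginHeegnerData_of_grossCM hCM1 hCM2 hK hH Dt β ι d.dvd_sq_sub
      (hc.squarefree_of_dvd hm') (hinert m' hm')
  let data : (m' : ℕ) → m' ∣ c → KolyvaginHeegnerData Dt β ι m' := fun m' hm' ↦
    if h : m' = c then h ▸ d else (hne m' hm').some
  have hdata : data c dvd_rfl = d := by simp [data]
  -- Gross Prop. 5.3 at every divisor of `c` (all `≠ 0` and prime to `N`), UNCONDITIONALLY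
  have h53 : ∀ (m : ℕ) (hm : m ∣ c) (τm : ringClassField K ι m ≃ₐ[ℚ] ringClassField K ι m),
      (∀ x : ringClassField K ι m, ((τm x : ringClassField K ι m) : ℂ) = starRingEnd ℂ x) →
      ∃ σ' ∈ ringClassGal ι m, IsOfFinAddOrder
        (pointGalHom W (ringClassField K ι m) τm (data m hm).y -
          (-W.rootNumber) • pointGalHom W (ringClassField K ι m) σ' (data m hm).y) := by
    intro m hm τm hτm
    obtain ⟨hm0, hmN⟩ := ne_zero_and_coprime_of_isKolyvaginPrime (K := K) (hc.squarefree_of_dvd hm)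
      (fun q hq ↦ (hcK q (Nat.primeFactors_mono hm hc.ne_zero hq)).1)
    exact exists_mem_ringClassGal_isOfFinAddOrder_conj_sub_smul W hK hH Dt ι hm0 hmN (data m hm) τm hτm
  -- Prop. 5.4 (2) at Zhang–Kolyvagin levels, admissibility at `2` from the route's landed theorem
  have h := conjAct_kolyvaginClass_eq_sign_smul_zhang (c := τ) hK ι Nat.prime_two hk Dt hND hD hc hcK
    data hτ (-W.rootNumber) h53
    (fun m hm ↦ KolyvaginAtTwo.isAdmissible_pointsSubgroup_two_of_heegner (data m hm) hs hK hodd hH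
      (ne_zero_of_dvd_ne_zero hc.ne_zero hm) k)
    c dvd_rfl
  rwa [hdata] at h

end OneConductor

/-- **T3 — complex conjugation acts on the depth-`ν` classes by one sign** (the registered stub
`stub_conjSign` of the line `kolyvagin_depth_split`, PROVED): on V2♭'s habitat and frame, for the
non-trivial automorphism `σ₀` of `K` and every depth `ν`, the sign `ε = −w(E)·(−1)^ν ∈ {1, −1}`
satisfies `σ₀_* c_M(n) = ε c_M(n)` for all `n ∈ Λ` with `ν` prime factors, every datum `d` and all
`1 ≤ M ≤ M(n)` (Gross 1991 Prop. 5.4 (2): `ε_n = ε·(−1)^ν`, `ε` the Fricke eigenvalue `= −w(E)`, from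
Prop. 5.3 `y_n^τ = ε σ' y_n + (torsion)` and `τ D_ℓ τ ≡ −D_ℓ (mod ℓ + 1)`; at `2` the torsion term is
harmless because `E(K[n])[2^∞] = 0` on the habitat). From `conjAct_kolyvaginClass_two_eq_sign_smul`
with `M ≤ M(n)` unfolded by `Zhang2014.natCast_le_levelIndex_iff`. HONEST: closes stub T3 only; V2♭ and
BSD are not proved by this.
[cite: GrossLMS1991, §5 Prop. 5.3, Prop. 5.4] [cite: McCallumLMS1991, §5 (ε_r = (−1)^r ε)] -/
theorem stub_conjSign :
    ∀ (W : WeierstrassCurve ℚ) [W.IsElliptic] [W.IsGloballyMinimal], ¬ W.HasCM →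
      (Rank1Residual.GoodOrd W 2 ∨ Rank1Residual.Mult W 2) →
      (∀ m : ℕ, W.HasSurjectiveModNGaloisRep (2 ^ m : ℕ)) →
      ∀ (K : Type) [Field K] [NumberField K], IsImaginaryQuadratic K → NumberField.discr K ≠ -3 →
      NumberField.discr K ≠ -4 → ¬ ((2 : ℤ) ∣ NumberField.discr K) → ∀ [NeZero (W.conductorNorm ℤ)],
      SatisfiesHeegnerHypothesis (W.conductorNorm ℤ) K →
      ∀ (Dt : ModularParametrizationData W (W.conductorNorm ℤ)) (β : ℤ) (ι : K →+* ℂ)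
        (σ₀ : K ≃ₐ[ℚ] K), σ₀ ≠ 1 → ∀ ν : ℕ, ∃ ε : ℤ, (ε = 1 ∨ ε = -1) ∧
        ∀ (n : ℕ) (d : KolyvaginHeegnerData Dt β ι n) (M : ℕ),
        KolyvaginDescent.KolSupp (Zhang2014.IsKolyvaginPrime (W.conductorNorm ℤ) W K 2) n →
        n.primeFactors.card = ν → 1 ≤ M → (M : ℕ∞) ≤ Zhang2014.levelIndex W 2 n →
          conjAct W σ₀ ((2 ^ M : ℕ) : ℤ) (d.kolyvaginClass Nat.prime_two M) =
            ε • d.kolyvaginClass Nat.prime_two M := by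
  intro W _ _ _ _ hsur K _ _ hK hne3 hne4 h2d _ hHN Dt β ι σ₀ hσ₀1 ν
  have hs : W.HasSurjectiveModNGaloisRep 2 := by simpa using hsur 1
  have hodd : Odd (NumberField.discr K) := by
    rcases Int.even_or_odd (NumberField.discr K) with h | h
    · exact absurd (even_iff_two_dvd.mp h) h2d
    · exact h
  refine ⟨-W.rootNumber * (-1) ^ ν, ?_, fun n d M hn hν hM1 hMle ↦ ?_⟩
  · rcases W.rootNumber_eq_one_or with h1 | h1 <;>
      rcases neg_one_pow_eq_or ℤ ν with h | h <;> simp [h1, h]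
  · subst hν
    exact conjAct_kolyvaginClass_two_eq_sign_smul hs hK hne3 hne4 hodd hHN σ₀ hσ₀1 Dt β ι hn.1 hM1
      (fun ℓ hℓ ↦ ⟨hn.2 ℓ hℓ, Zhang2014.natCast_le_levelIndex_iff.mp hMle ℓ hℓ⟩) d

end Summit.BirchSwinnertonDyer.BirchSwinnertonDyer.Theorems.KolyvaginLowerBoundAtTwo

end
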